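import Summits.AtomisticToContinuum.BoseEinsteinCondensation.Theorems.BECGroundStateSOSPeriodicIRBoundFsumDefs
import Summits.AtomisticToContinuum.BoseEinsteinCondensation.Theorems.BECGroundStateSOSPeriodicIRBoundFsumDCAdjoint
import Summits.AtomisticToContinuum.BoseEinsteinCondensation.Theorems.BECGroundStateSOSPeriodicIRBoundFsumConePhaseUp
import Summits.AtomisticToContinuum.BoseEinsteinCondensation.Theorems.BECGroundStateSOSPeriodicIRBoundFsumConeBlock
import Summits.AtomisticToContinuum.BoseEinsteinCondensation.Theorems.BECGroundStateSOSPeriodicIRBoundFsumDCKinetic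
import HarnessLib

/-!
# Crux `PeriodicIRBound` (stmt-AtomisticToContinuum-3972), line `fsum-phase-pencil`, helper Q1
# `stub_backflowOfStatic` — the static backflow-current bound implies the backflow bound

With `U_k = phaseUp L k`, `W_k = kinCommutator L k`, `k̃ = waveVector L k` and the residual current
`R_kΨ = W_kΨ − ‖k̃‖² U_kΨ`, the backflow correlation is
`β_k(Ψ) := Re⟨U_kΨ, W_kΨ⟩ − ‖k̃‖² ‖U_kΨ‖² = Re⟨U_kΨ, R_kΨ⟩` (`innerRe` is `ℝ`-linear in the second slot and
`Re⟨f, f⟩ = ‖f‖²`). Cauchy–Schwarz on the cell gives `β_k² ≤ ‖U_kΨ‖² ‖R_kΨ‖²`, so the STATIC bound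
`‖R_kΨ‖² ≤ C N ‖k̃‖⁴ + ε'` (`StaticBackflowCurrent`) yields
`|β_k| ≤ √C √N ‖k̃‖² ‖U_kΨ‖ + ‖U_kΨ‖ √ε' ≤ √C (N√ρ‖k̃‖ + √N ‖k̃‖² ‖U_kΨ‖) + ε` once `ε' = ε²/(4N² + 1)`
(`‖U_kΨ‖² ≤ 4N²` for a normalised state, `normSq_phaseUp_le`): this is `BackflowBound` with constant `√C`.
-/

noncomputable section

open MeasureTheory Filter
open scoped ENNReal NNReal ComplexConjugate BigOperators

namespace Summit.AtomisticToContinuum.BoseEinsteinCondensation.Cruxes.PeriodicIRBound.FsumPhasePencil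

open Literature.MathematicalPhysics.QuantumManyBody.BoseGas
open Summit.AtomisticToContinuum.BoseEinsteinCondensation.Theorems.PeriodicIRBound.Negative
  (NearMin InWindow IRBoundFor)
open Summit.AtomisticToContinuum.BoseEinsteinCondensation.Cruxes.PeriodicIRBound.LinearPhFloorWagner.WF

variable {M n : ℕ} {L : ℝ}

/-! ## The residual current `R_k = W_k − ‖k̃‖² U_k` and the backflow correlation -/

section Residual

/-- `W_kΨ = kinCommutator L k Ψ` is continuous for a `C¹` function `Ψ` (a finite sum of products of the smooth
waves `e_k(xⱼ)` with `Ψ` and its first directional derivatives). [folklore] -/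
theorem continuous_kinCommutator (L : ℝ) (k : Fin 3 → ℤ) {Ψ : Config M → ℂ} (hΨ : ContDiff ℝ 1 Ψ) :
    Continuous (kinCommutator L k Ψ) := by
  unfold kinCommutator
  exact continuous_finsetSum _ fun j _ => ((contDiff_cellWave_comp_apply (n := 0) L k j).continuous).mul
    ((continuous_const.mul hΨ.continuous).sub (continuous_const.mul (continuous_fderiv_apply_const hΨ _)))

/-- The backflow correlation is the pairing with the residual current:
`Re⟨U_kΨ, W_kΨ⟩ − ‖k̃‖² ‖U_kΨ‖² = Re⟨U_kΨ, W_kΨ − ‖k̃‖² U_kΨ⟩` for a `C¹` `(n+1)`-body `Ψ`. [folklore] -/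
theorem backflow_eq_innerRe_residual (L : ℝ) (k : Fin 3 → ℤ) {Ψ : Config (n + 1) → ℂ} (hΨ : ContDiff ℝ 1 Ψ) :
    innerRe L (phaseUp L k Ψ) (kinCommutator L k Ψ) -
        ‖waveVector L k‖ ^ 2 * (normSq L (phaseUp L k Ψ)).toReal =
      innerRe L (phaseUp L k Ψ) (fun X => kinCommutator L k Ψ X -
        (((‖waveVector L k‖ ^ 2 : ℝ)) : ℂ) * phaseUp L k Ψ X) := by
  have hU : Continuous (phaseUp L k Ψ) := continuous_phaseUp L k hΨ.continuous
  have hW : Continuous (kinCommutator L k Ψ) := continuous_kinCommutator L k hΨ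
  rw [innerRe_sub_right (h := fun X => (((‖waveVector L k‖ ^ 2 : ℝ)) : ℂ) * phaseUp L k Ψ X) hU hW
    (continuous_const.mul hU), innerRe_smul_right, innerRe_self hU]

/-- **Cauchy–Schwarz for the backflow correlation**:
`(Re⟨U_kΨ, W_kΨ⟩ − ‖k̃‖² ‖U_kΨ‖²)² ≤ ‖U_kΨ‖² · ‖W_kΨ − ‖k̃‖² U_kΨ‖²` for a `C¹` `(n+1)`-body `Ψ`. [folklore] -/
theorem sq_backflow_le (L : ℝ) (k : Fin 3 → ℤ) {Ψ : Config (n + 1) → ℂ} (hΨ : ContDiff ℝ 1 Ψ) :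
    (innerRe L (phaseUp L k Ψ) (kinCommutator L k Ψ) -
        ‖waveVector L k‖ ^ 2 * (normSq L (phaseUp L k Ψ)).toReal) ^ 2 ≤
      (normSq L (phaseUp L k Ψ)).toReal *
        (normSq L (fun X => kinCommutator L k Ψ X -
          (((‖waveVector L k‖ ^ 2 : ℝ)) : ℂ) * phaseUp L k Ψ X)).toReal := by
  have hU : Continuous (phaseUp L k Ψ) := continuous_phaseUp L k hΨ.continuous
  have hW : Continuous (kinCommutator L k Ψ) := continuous_kinCommutator L k hΨ
  rw [backflow_eq_innerRe_residual L k hΨ]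
  exact innerRe_sq_le hU (hW.sub (continuous_const.mul hU))

/-- `‖U_kΨ‖² ≤ 4(n+1)²` as a real number, for a core `(n+1)`-body `Ψ` with `‖Ψ‖² = 1`. [folklore] -/
theorem toReal_normSq_phaseUp_le (hL : 0 < L) (k : Fin 3 → ℤ) {Ψ : Config (n + 1) → ℂ} (hΨ : IsCore L Ψ)
    (hn : normSq L Ψ = 1) :
    (normSq L (phaseUp L k Ψ)).toReal ≤ 4 * ((n + 1 : ℕ) : ℝ) ^ 2 := by
  have h := normSq_phaseUp_le hL k hΨ (D := 1) hn.le
  have hcast : (4 * ((n + 1 : ℝ≥0∞) * (n + 1 : ℝ≥0∞)) * 1) = ((4 * ((n + 1) * (n + 1)) : ℕ) : ℝ≥0∞) := by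
    push_cast
    ring
  rw [hcast] at h
  have h' := ENNReal.toReal_mono (ENNReal.natCast_ne_top _) h
  rw [ENNReal.toReal_natCast] at h'
  calc (normSq L (phaseUp L k Ψ)).toReal ≤ ((4 * ((n + 1) * (n + 1)) : ℕ) : ℝ) := h'
    _ = 4 * ((n + 1 : ℕ) : ℝ) ^ 2 := by
        push_cast
        ring

end Residual

/-! ## Real-number bookkeeping -/

section Algebra

/-- The slack `ε' = ε²/(4N² + 1)` is positive. [folklore] -/
theorem slack_pos {ε N : ℝ} (hε : 0 < ε) : 0 < ε ^ 2 / (4 * N ^ 2 + 1) := by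
  positivity

/-- With `u ≤ 4N²`: `u · ε²/(4N² + 1) ≤ ε²`. [folklore] -/
theorem mul_slack_le {u ε N : ℝ} (hu4 : u ≤ 4 * N ^ 2) : u * (ε ^ 2 / (4 * N ^ 2 + 1)) ≤ ε ^ 2 := by
  have hD : 0 < 4 * N ^ 2 + 1 := by positivity
  rw [← mul_div_assoc, div_le_iff₀ hD]
  nlinarith [sq_nonneg ε, mul_le_mul_of_nonneg_right hu4 (sq_nonneg ε)]

/-- The quadratic bookkeeping of the Cauchy–Schwarz step: from `β² ≤ u r`, `r ≤ C N K² + ε'` and `u ε' ≤ ε²`,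
`|β| ≤ √C (√N K √u) + ε`. [folklore] -/
theorem abs_le_of_sq_le_mul {β u r C N K ε ε' : ℝ} (hu : 0 ≤ u) (hC : 0 ≤ C) (hN : 0 ≤ N) (hK : 0 ≤ K)
    (hε : 0 ≤ ε) (hβ : β ^ 2 ≤ u * r) (hr : r ≤ C * N * K ^ 2 + ε') (huε : u * ε' ≤ ε ^ 2) :
    |β| ≤ Real.sqrt C * (Real.sqrt N * K * Real.sqrt u) + ε := by
  have hP : 0 ≤ Real.sqrt C * (Real.sqrt N * K * Real.sqrt u) := by positivity
  refine abs_le_of_sq_le_sq ?_ (add_nonneg hP hε)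
  have h1 : β ^ 2 ≤ C * N * K ^ 2 * u + ε ^ 2 := by
    have h := mul_le_mul_of_nonneg_left hr hu
    nlinarith [h]
  have h2 : (Real.sqrt C * (Real.sqrt N * K * Real.sqrt u)) ^ 2 = C * N * K ^ 2 * u := by
    rw [mul_pow, mul_pow, mul_pow, Real.sq_sqrt hC, Real.sq_sqrt hN, Real.sq_sqrt hu]
    ring
  nlinarith [mul_nonneg hP hε, h2]

end Algebra

/-! ## The implication -/

section Main

/-- **The static backflow-current bound implies the backflow bound** (Cauchy–Schwarz on the cell), with the
constant `√C` and the same density threshold `ρ₀`. [folklore] -/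
theorem backflowBound_of_staticBackflowCurrent (hS : StaticBackflowCurrent) : BackflowBound := by
  intro R₀ V₁ hR₀ hV₁ κ hκ
  obtain ⟨ρ₀, hρ₀, C, hC, hS'⟩ := hS R₀ V₁ hR₀ hV₁ κ hκ
  refine ⟨ρ₀, hρ₀, Real.sqrt C, Real.sqrt_pos.2 hC, fun ρ hρ hρ₀' => ?_⟩
  filter_upwards [hS' ρ hρ hρ₀'] with N hN
  intro w hw hE k hk ε hε
  obtain ⟨δ, hδ, hδ'⟩ := hN w hw hE k hk (ε ^ 2 / (4 * (N : ℝ) ^ 2 + 1)) (slack_pos hε)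
  refine ⟨δ, hδ, fun Ψ hΨ => ?_⟩
  have hr := hδ' Ψ hΨ
  cases N with
  | zero =>
    rw [phaseUp_zero, innerRe_zero_left]
    have h0 : normSq (sideLength ρ 0) (0 : Config 0 → ℂ) = 0 := by simp [normSq]
    rw [h0, ENNReal.toReal_zero, Real.sqrt_zero, mul_zero, sub_zero, abs_zero]
    positivity
  | succ n =>
    have hL : 0 < sideLength ρ (n + 1) := sideLength_pos_of_pos hρ n.succ_pos
    have hcore : IsCore (sideLength ρ (n + 1)) Ψ.ψ := isCore_trialState Ψ
    have hn1 : normSq (sideLength ρ (n + 1)) Ψ.ψ = 1 := Ψ.norm_eq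
    have hu4 := toReal_normSq_phaseUp_le hL k hcore hn1
    have hβ := sq_backflow_le (sideLength ρ (n + 1)) k Ψ.contDiff
    have hK4 : C * ((n + 1 : ℕ) : ℝ) * ‖waveVector (sideLength ρ (n + 1)) k‖ ^ 4 =
        C * ((n + 1 : ℕ) : ℝ) * (‖waveVector (sideLength ρ (n + 1)) k‖ ^ 2) ^ 2 := by ring
    rw [hK4] at hr
    have hmain := abs_le_of_sq_le_mul ENNReal.toReal_nonneg hC.le (Nat.cast_nonneg _) (sq_nonneg _) hε.le hβ hr
      (mul_slack_le hu4)
    refine hmain.trans (add_le_add (mul_le_mul_of_nonneg_left ?_ (Real.sqrt_nonneg C)) le_rfl)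
    have : 0 ≤ ((n + 1 : ℕ) : ℝ) * Real.sqrt ρ * ‖waveVector (sideLength ρ (n + 1)) k‖ := by positivity
    linarith

/-- **Registered helper stub `stub_backflowOfStatic`** (line `fsum-phase-pencil`, Q1): the static
backflow-current bound `StaticBackflowCurrent` implies the backflow bound `BackflowBound` (S1). [folklore] -/
theorem stub_backflowOfStatic : StaticBackflowCurrent → BackflowBound :=
  backflowBound_of_staticBackflowCurrent

end Main

end Summit.AtomisticToContinuum.BoseEinsteinCondensation.Cruxes.PeriodicIRBound.FsumPhasePencil

end
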